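/-
Copyright (c) 2026 the pub-hodgecm-mathlib formalisation cell (harness21).  Prover seat hodgecm-mathlib-LH4-p17 (g3) (Track A «FOUR-FRAME» free hand routed to L1 by the
CHAIR VALVE; LEAD F0P6-plan (g15) BATCH #243 «(D-arch-P)», this seat's CENSUS 2026-09-05T01:54:58Z cut (α) FILE A; block-D desk K2Liu-p12; package F0P2-p11 (g3) ★ p864094;
consumers ★ p863709 `K2LiuIncoherentRankOneBlockDFacesOfWitness` ∕ ★ p863921 ∕ ★ p864236 ∕ ★ p864260 at REFINED faces), Track B «K2-LIT», #184♮ = hLiu418 = `stmt-HodgeConjecture-24832`.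
THEOREMS ONLY (no `def`, no instance, no notation, no named-fact hypothesis, no `sorry`, default heartbeats).
-/
import Summits.HodgeConjecture.HodgeConjecture.Theorems.K2LiuIncoherentRankOneArchSplitOfFaces   -- ★ p863921 (this seat): `continuation_eq_const_mul_prod`'s identity-theorem currency + frame vocabulary
import HarnessLib

/-!
# Crux `HLiu418`, #42S organ S5, BLOCK D — FACE REFINEMENT OF THE K1-a♮ WITNESS: faces `j` whose archimedean block is a finite SUM `Σ_{r ∈ R j}` of blocks become faces `(j, r)`
# (the witness equation `hEq` of ★ p863404 ∕ ★ p863709 re-indexed over `(I X h).sigma (R X)` — so block D's per-face PLACE SPLIT applies to place-PURE faces)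

Cell `hodgecm-mathlib`, crux item hLiu418 = `stmt-HodgeConjecture-24832`, route `HCCMUnconditional`; squad K2 ∕ K2Liu (L1, LEAD F0P6-plan (g15)).  Lane
`--supports stmt-HodgeConjecture-24832 --as helper` (count-neutral).  CLOSES NO SOCKET.

WHY (this seat's (D-arch-P) CENSUS 01:54:58Z).  Block D reads the K1-a♮ package ★ p863404 through its witness equation (★ p863709 `hdead_of_packageWitness_rows_hbad`, binder `hEq`)
  `Eac X s h = c X h · (Σ_{i ∈ I X h} Ac X i s h · ∏_{v ∈ T X h} Gn X i v s h) · Gs X h s · ∏_{v ∈ D X h} P X h v s`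
and then splits EACH face's archimedean value over the complex places (`hsplit`, ★ p863921; from a PURE-TENSOR presentation of the face's archimedean integrand through the tube frame,
★ p864260's letter `hpure`).  The faces of record are the (KW-fac) pure tensors `j : Fin m` (★ `K2LiuKindWFactorizableDecomposition.exists_kindW_factorization`), whose archimedean
slice `H_𝒦(a)^{2(s−s₀)} · A j a` is a GLOBAL `K_∞`-finite section; its place structure (★ `K2LiuArchFlatTubePresentation.exists_flat_tube_presentation`, K2Liu-p11) is a finite SUM
`Σ_{r<m′} c_r ∏_w F̃_{r,w}(Fr(a·g) w)` of place-pure flat tube products — so the face `j` is place-pure only after REFINEMENT to the pairs `(j, r)`.  Since the finite-place factors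
`Gn X j v s h`, the sets `T D Pm` and the scalar do not see `r`, the refinement is pure algebra on the witness:
  `Σ_{j ∈ I} Ac_j · W_j = Σ_{(j,r) ∈ I.sigma R} Ac′_{(j,r)} · W_j`   whenever   `Ac_j = Σ_{r ∈ R j} Ac′_{(j,r)}`  (`Finset.sum_sigma`, `Finset.sum_mul`),
and every face-indexed letter that does not see the archimedean block (D-2 `hbad` about `Gn`, D-5, …) transfers to the fine faces through `p ↦ p.1`.  The decomposition of the
CONTINUED block `Ac X j s h = Σ_r Ac′ X ⟨j,r⟩ s h` (all `s`) is DEFINITIONAL for the payer who continues term by term (★ `K2LiuArchFaceOfPresentation.archFace_of_presentation`'s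
`E := Σ_r γ_r · E_r`); when `Ac` was chosen otherwise, §1's identity theorem recovers it on `{0 < re}` from the raw decomposition on `{1 < re}`.
THIS FILE (hypothesis-first; generic §1, frame §2):
* §1 `sum_mul_eq_sum_sigma_mul` (the re-indexing algebra), `forall_mem_sigma_of_forall_mem` (letters not seeing `r` transfer), **`continuation_eq_sum`** (identity theorem: raw
  decomposition on `{c₀ < re}` + holomorphy ⟹ continued decomposition on `{0 < re}`), `hAc_sigma_of_forall` (holomorphy letter `hAc` at fine faces from the `∀ j ∈ I, ∀ r ∈ R j` form).
* §2 AT THE K2_Liu FRAME: **`hEq_sigma_of_faceDecomposition`** — ★ p863709's `hEq` binder (coarse faces `I`, block `Ac`, values `Gn`) + `R Ac′ hdecAc` ⟹ ★ p863709's `hEq` binder VERBATIM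
  at `I′ X h := (I X h).sigma (R X)`, `Ac′`, `Gn′ X p v s h := Gn X p.1 v s h` (same `Eac c T Pm G D P`); **`hAc_sigma`**, **`hbad_sigma`** (★ p863404's `hAc` and ★ p863709's RAW
  `hbad` at the fine faces from their coarse∕per-term forms); **`ac_eq_sum_of_rawDecomposition`** (§1's identity theorem at the frame, for payers holding only the raw decomposition).
HONEST LABEL.  Count-neutral helper (finite-sum algebra + the identity theorem); the decomposition letters enter BY VALUE (payer: the archimedean continuation of the (KW-fac) faces
term by term over ★ `exists_flat_tube_presentation`); `HC_CM` is proved only modulo the 7 printed citations (2 remaining named inputs: hLiu418 = `stmt-HodgeConjecture-24832`,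
h413 = `stmt-HodgeConjecture-24833`) until rung 0 closes.

## References
* [KudlaRallis1994] S. Kudla, S. Rallis, *A regularized Siegel–Weil formula: the first term identity*, Ann. of Math. 140 (1994): §2 (2.10)–(2.12) (Whittaker coefficients of
  `K`-finite sections as finite sums of factorizable terms).
* [Shimura1997] G. Shimura, *Euler Products and Eisenstein Series*, CBMS 93 (1997): §16.4, §18.4 (archimedean sections as sums of pure tensors over the places).
* [Conway1978] J. B. Conway, *Functions of One Complex Variable I*: IV §3 Thm. 3.7 (identity theorem).
* [BorelJacquet1979] A. Borel, H. Jacquet, *Automorphic forms and automorphic representations*, PSPM 33.1 (1979): §4.1.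
-/

set_option autoImplicit false
set_option linter.dupNamespace false -- the mandated namespace repeats `HodgeConjecture.HodgeConjecture`

noncomputable section

open scoped Matrix
open NumberField NumberField.InfinitePlace IsDedekindDomain
open Literature.NumberTheory.QuadraticForms
open Literature.NumberTheory.Automorphic Literature.NumberTheory.Automorphic.UnitaryGroup Literature.NumberTheory.GaloisRepresentations
open Literature.NumberTheory.GelbartRogawski1991 Literature.NumberTheory.GelbartRogawski1991.GRConstruction

namespace Summit.HodgeConjecture.HodgeConjecture.Cruxes.HLiu418.K2LiuIncoherentRankOneFaceRefinement

open K2LiuSiegelUnipotentFourierDefs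
open K2LiuFourierCoeffContinuedEuler (eqOn_halfPlane_of_eqOn_halfPlane)

/-! ## §1 Generic: re-indexing a sum of faces over a sigma type; the identity theorem for finite sums -/

/-- **RE-INDEXING ALGEBRA.**  If every coarse block is the sum of its fine blocks, `Ac j = Σ_{r ∈ R j} Ac′ ⟨j, r⟩` (`j ∈ I`), then for any face weights `W j` not seeing `r`:
`Σ_{j ∈ I} Ac j · W j = Σ_{p ∈ I.sigma R} Ac′ p · W p.1` (`Finset.sum_sigma`, `Finset.sum_mul`). [cite: KudlaRallis1994, §2 (2.10)–(2.12)] -/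
theorem sum_mul_eq_sum_sigma_mul {φ ρ : Type*} (I : Finset φ) (R : φ → Finset ρ) (Ac : φ → ℂ) (Ac' : (Sigma fun _ : φ => ρ) → ℂ)
    (hdec : ∀ j ∈ I, Ac j = ∑ r ∈ R j, Ac' ⟨j, r⟩) (W : φ → ℂ) :
    ∑ j ∈ I, Ac j * W j = ∑ p ∈ I.sigma R, Ac' p * W p.1 := by
  rw [Finset.sum_sigma]
  exact Finset.sum_congr rfl fun j hj => by rw [hdec j hj, Finset.sum_mul]

/-- **LETTERS NOT SEEING THE REFINEMENT TRANSFER**: a property of coarse faces holds at `p.1` for every fine face `p ∈ I.sigma R`. [cite: BorelJacquet1979, §4.1] -/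
theorem forall_mem_sigma_of_forall_mem {φ ρ : Type*} (I : Finset φ) (R : φ → Finset ρ) {P : φ → Prop} (h : ∀ j ∈ I, P j) :
    ∀ p ∈ I.sigma R, P p.1 :=
  fun p hp => h p.1 (Finset.mem_sigma.1 hp).1

/-- **THE IDENTITY THEOREM FOR A FINITE SUM OF CONTINUATIONS.**  On `{c₀ < re}` (`0 ≤ c₀`) the raw block `A` agrees with its continuation `Ac`, each raw fine block `A′ r` (`r ∈ R`) with its
continuation `Ac′ r`, and `A = Σ_{r ∈ R} A′ r`; all continuations holomorphic on `{0 < re}` ⟹ `Ac s = Σ_{r ∈ R} Ac′ r s` at EVERY `0 < re s`.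
[cite: Conway1978, IV §3 Thm. 3.7] [cite: Shimura1997, §18.4] -/
theorem continuation_eq_sum {ρ : Type*} {c₀ : ℝ} (hc₀ : 0 ≤ c₀) (R : Finset ρ)
    {A Ac : ℂ → ℂ} (hAc : DifferentiableOn ℂ Ac {s : ℂ | 0 < s.re}) (hA : ∀ s : ℂ, c₀ < s.re → A s = Ac s)
    {A' Ac' : ρ → ℂ → ℂ} (hAc' : ∀ r ∈ R, DifferentiableOn ℂ (Ac' r) {s : ℂ | 0 < s.re})
    (hA' : ∀ r ∈ R, ∀ s : ℂ, c₀ < s.re → A' r s = Ac' r s)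
    (hdec : ∀ s : ℂ, c₀ < s.re → A s = ∑ r ∈ R, A' r s) :
    ∀ s : ℂ, 0 < s.re → Ac s = ∑ r ∈ R, Ac' r s := by
  have h₂ : DifferentiableOn ℂ (fun s => ∑ r ∈ R, Ac' r s) {s : ℂ | 0 < s.re} := DifferentiableOn.fun_sum fun r hr => hAc' r hr
  have heq : ∀ s : ℂ, c₀ < s.re → Ac s = ∑ r ∈ R, Ac' r s := fun s hs => by
    rw [← hA s hs, hdec s hs]
    exact Finset.sum_congr rfl fun r hr => hA' r hr s hs
  intro s hs
  exact eqOn_halfPlane_of_eqOn_halfPlane hc₀ hAc h₂ heq hs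

/-- **HOLOMORPHY AT THE FINE FACES** from the per-term form: `∀ j ∈ I, ∀ r ∈ R j, holomorphic (Ac′ ⟨j,r⟩)` ⟹ `∀ p ∈ I.sigma R, holomorphic (Ac′ p)`. [cite: Conway1978, IV §3 Thm. 3.7] -/
theorem hAc_sigma_of_forall {φ ρ : Type*} (I : Finset φ) (R : φ → Finset ρ) {Ac' : (Sigma fun _ : φ => ρ) → ℂ → ℂ} {U : Set ℂ}
    (h : ∀ j ∈ I, ∀ r ∈ R j, DifferentiableOn ℂ (Ac' ⟨j, r⟩) U) :
    ∀ p ∈ I.sigma R, DifferentiableOn ℂ (Ac' p) U :=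
  fun p hp => by
    obtain ⟨hj, hr⟩ := Finset.mem_sigma.1 hp
    exact h p.1 hj p.2 hr

/-! ## §2 At the K2_Liu frame: ★ p863709's `hEq` binder at the refined faces -/

section Frame

variable (L : Type) [Field L] [NumberField L] [IsCMField L]

variable {N M n : ℕ} (e : Fin N × Fin M ≃ Fin n)
  (dV : Fin N → L) (hdV : ∀ i, IsCMField.complexConj L (dV i) = dV i)
  (dW : Fin M → L) (hdW : ∀ i, IsCMField.complexConj L (dW i) = dW i)

/-- **THE WITNESS AT THE REFINED FACES (the head).**  ★ p863709 `hdead_of_packageWitness_rows_hbad`'s `hEq` binder (coarse faces `I X h : Finset φ`, block `Ac`, values `Gn`, moving set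
`Pm`, scalar `G`, shells `D P`; bytes VERBATIM) and a finite decomposition of the CONTINUED archimedean block of every coarse face, `Ac X j s h = Σ_{r ∈ R X j} Ac′ X ⟨j, r⟩ s h` (all `s`;
definitional for the payer who continues term by term, else §1 `continuation_eq_sum` on `{0 < re}`) ⟹ the SAME `hEq` binder at the fine faces: `I′ X h := (I X h).sigma (R X)`,
block `Ac′`, values `Gn′ X p v s h := Gn X p.1 v s h`, everything else unchanged — so ★ p863709 ∕ ★ p864094 ∕ ★ p863921 ∕ ★ p864236 ∕ ★ p864260 apply VERBATIM at the face type
`Σ _ : φ, ρ`. [cite: KudlaRallis1994, §2 (2.10)–(2.12)] [cite: Shimura1997, §16.4, §18.4] -/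
theorem hEq_sigma_of_faceDecomposition {φ ρ : Type*}
    {Eac : skewMatrices ((IsCMField.complexConj L : L ≃ₐ[Fp L] L) : L →+* L) ((gramR L e dV hdV dW hdW).map (algebraMap (Fp L) L)) → ℂ → HA L e dV hdV dW hdW → ℂ}
    {c : skewMatrices ((IsCMField.complexConj L : L ≃ₐ[Fp L] L) : L →+* L) ((gramR L e dV hdV dW hdW).map (algebraMap (Fp L) L)) → HA L e dV hdV dW hdW → ℂ}
    {I : skewMatrices ((IsCMField.complexConj L : L ≃ₐ[Fp L] L) : L →+* L) ((gramR L e dV hdV dW hdW).map (algebraMap (Fp L) L)) → HA L e dV hdV dW hdW → Finset φ}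
    {Ac : skewMatrices ((IsCMField.complexConj L : L ≃ₐ[Fp L] L) : L →+* L) ((gramR L e dV hdV dW hdW).map (algebraMap (Fp L) L)) → φ → ℂ → HA L e dV hdV dW hdW → ℂ}
    {T : skewMatrices ((IsCMField.complexConj L : L ≃ₐ[Fp L] L) : L →+* L) ((gramR L e dV hdV dW hdW).map (algebraMap (Fp L) L)) → HA L e dV hdV dW hdW →
      Finset (HeightOneSpectrum (𝓞 ↥(maximalRealSubfield L)))}
    {Gn : skewMatrices ((IsCMField.complexConj L : L ≃ₐ[Fp L] L) : L →+* L) ((gramR L e dV hdV dW hdW).map (algebraMap (Fp L) L)) → φ →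
      HeightOneSpectrum (𝓞 ↥(maximalRealSubfield L)) → ℂ → HA L e dV hdV dW hdW → ℂ}
    {Pm : skewMatrices ((IsCMField.complexConj L : L ≃ₐ[Fp L] L) : L →+* L) ((gramR L e dV hdV dW hdW).map (algebraMap (Fp L) L)) → HA L e dV hdV dW hdW →
      Finset (HeightOneSpectrum (𝓞 ↥(maximalRealSubfield L)))}
    {G : ℂ → ℂ}
    {D : skewMatrices ((IsCMField.complexConj L : L ≃ₐ[Fp L] L) : L →+* L) ((gramR L e dV hdV dW hdW).map (algebraMap (Fp L) L)) → HA L e dV hdV dW hdW →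
      Finset (HeightOneSpectrum (𝓞 ↥(maximalRealSubfield L)))}
    {P : skewMatrices ((IsCMField.complexConj L : L ≃ₐ[Fp L] L) : L →+* L) ((gramR L e dV hdV dW hdW).map (algebraMap (Fp L) L)) → HA L e dV hdV dW hdW →
      HeightOneSpectrum (𝓞 ↥(maximalRealSubfield L)) → ℂ → ℂ}
    (hEq : ∀ (X : skewMatrices ((IsCMField.complexConj L : L ≃ₐ[Fp L] L) : L →+* L) ((gramR L e dV hdV dW hdW).map (algebraMap (Fp L) L))) (s : ℂ) (h : HA L e dV hdV dW hdW),
      (X : Matrix (Fin n) (Fin n) L) ≠ 0 → (X : Matrix (Fin n) (Fin n) L).det = 0 →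
      Eac X s h = c X h * (∑ i ∈ I X h, Ac X i s h * ∏ v ∈ T X h, Gn X i v s h) * ((∏ v ∈ Pm X h, ((1 - (v.residueCard : ℂ) ^ (-(2 * s))) / ((1 - (v.residueCard : ℂ) ^ (-(2 * s + 1))) * (1 - (quadraticHeckeCharCM L).valueAtUniformizer v * (v.residueCard : ℂ) ^ (-(2 * s + 2)))))) * G s) * ∏ v ∈ D X h, P X h v s)
    -- the refinement: fine index sets and fine blocks, and the decomposition of the continued coarse block (all `s`)
    (R : skewMatrices ((IsCMField.complexConj L : L ≃ₐ[Fp L] L) : L →+* L) ((gramR L e dV hdV dW hdW).map (algebraMap (Fp L) L)) → φ → Finset ρ)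
    (Ac' : skewMatrices ((IsCMField.complexConj L : L ≃ₐ[Fp L] L) : L →+* L) ((gramR L e dV hdV dW hdW).map (algebraMap (Fp L) L)) → (Sigma fun _ : φ => ρ) → ℂ →
      HA L e dV hdV dW hdW → ℂ)
    (hdecAc : ∀ X : skewMatrices ((IsCMField.complexConj L : L ≃ₐ[Fp L] L) : L →+* L) ((gramR L e dV hdV dW hdW).map (algebraMap (Fp L) L)),
      (X : Matrix (Fin n) (Fin n) L) ≠ 0 → (X : Matrix (Fin n) (Fin n) L).det = 0 → ∀ (h : HA L e dV hdV dW hdW), ∀ j ∈ I X h, ∀ s : ℂ,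
        Ac X j s h = ∑ r ∈ R X j, Ac' X ⟨j, r⟩ s h) :
    ∀ (X : skewMatrices ((IsCMField.complexConj L : L ≃ₐ[Fp L] L) : L →+* L) ((gramR L e dV hdV dW hdW).map (algebraMap (Fp L) L))) (s : ℂ) (h : HA L e dV hdV dW hdW),
      (X : Matrix (Fin n) (Fin n) L) ≠ 0 → (X : Matrix (Fin n) (Fin n) L).det = 0 →
      Eac X s h = c X h * (∑ i ∈ (I X h).sigma (R X), Ac' X i s h * ∏ v ∈ T X h, (fun X (p : Sigma fun _ : φ => ρ) v s h => Gn X p.1 v s h) X i v s h) *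
        ((∏ v ∈ Pm X h, ((1 - (v.residueCard : ℂ) ^ (-(2 * s))) / ((1 - (v.residueCard : ℂ) ^ (-(2 * s + 1))) * (1 - (quadraticHeckeCharCM L).valueAtUniformizer v * (v.residueCard : ℂ) ^ (-(2 * s + 2)))))) * G s) * ∏ v ∈ D X h, P X h v s := by
  intro X s h hX0 hdet
  rw [hEq X s h hX0 hdet, sum_mul_eq_sum_sigma_mul (I X h) (R X) (fun j => Ac X j s h) (fun p => Ac' X p s h)
    (fun j hj => hdecAc X hX0 hdet h j hj s) (fun j => ∏ v ∈ T X h, Gn X j v s h)]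

/-- **★ p863404's `hAc` AT THE FINE FACES** from the per-term holomorphy `∀ j ∈ I X h, ∀ r ∈ R X j, DifferentiableOn ℂ (fun s => Ac′ X ⟨j,r⟩ s h) {0 < re}`.
[cite: Conway1978, IV §3 Thm. 3.7] [cite: Shimura1997, §18.4] -/
theorem hAc_sigma {φ ρ : Type*}
    (I : skewMatrices ((IsCMField.complexConj L : L ≃ₐ[Fp L] L) : L →+* L) ((gramR L e dV hdV dW hdW).map (algebraMap (Fp L) L)) → HA L e dV hdV dW hdW → Finset φ)
    (R : skewMatrices ((IsCMField.complexConj L : L ≃ₐ[Fp L] L) : L →+* L) ((gramR L e dV hdV dW hdW).map (algebraMap (Fp L) L)) → φ → Finset ρ)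
    (Ac' : skewMatrices ((IsCMField.complexConj L : L ≃ₐ[Fp L] L) : L →+* L) ((gramR L e dV hdV dW hdW).map (algebraMap (Fp L) L)) → (Sigma fun _ : φ => ρ) → ℂ →
      HA L e dV hdV dW hdW → ℂ)
    (hAc' : ∀ X : skewMatrices ((IsCMField.complexConj L : L ≃ₐ[Fp L] L) : L →+* L) ((gramR L e dV hdV dW hdW).map (algebraMap (Fp L) L)),
      (X : Matrix (Fin n) (Fin n) L) ≠ 0 → (X : Matrix (Fin n) (Fin n) L).det = 0 → ∀ (h : HA L e dV hdV dW hdW), ∀ j ∈ I X h, ∀ r ∈ R X j,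
        DifferentiableOn ℂ (fun s => Ac' X ⟨j, r⟩ s h) {s : ℂ | 0 < s.re}) :
    ∀ X : skewMatrices ((IsCMField.complexConj L : L ≃ₐ[Fp L] L) : L →+* L) ((gramR L e dV hdV dW hdW).map (algebraMap (Fp L) L)),
      (X : Matrix (Fin n) (Fin n) L) ≠ 0 → (X : Matrix (Fin n) (Fin n) L).det = 0 → ∀ (h : HA L e dV hdV dW hdW), ∀ i ∈ (I X h).sigma (R X),
        DifferentiableOn ℂ (fun s => Ac' X i s h) {s : ℂ | 0 < s.re} :=
  fun X hX0 hdet h => hAc_sigma_of_forall (I X h) (R X) (Ac' := fun p s => Ac' X p s h) (hAc' X hX0 hdet h)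

/-- **★ p863709's RAW `hbad` AT THE FINE FACES**: the D-2 letter about the bad-place values `Gn X i v ½ h` of the coarse faces transfers to the fine faces, whose values are
`Gn′ X p v ½ h := Gn X p.1 v ½ h`. [cite: KudlaRallis1994, §2 (2.10)–(2.12)] -/
theorem hbad_sigma {φ ρ : Type*}
    {ι : skewMatrices ((IsCMField.complexConj L : L ≃ₐ[Fp L] L) : L →+* L) ((gramR L e dV hdV dW hdW).map (algebraMap (Fp L) L)) → Type}
    (S₁ : Finset (HeightOneSpectrum (𝓞 ↥(maximalRealSubfield L))))
    (val : Matrix (Fin n) (Fin n) L → ↥(maximalRealSubfield L))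
    (I : skewMatrices ((IsCMField.complexConj L : L ≃ₐ[Fp L] L) : L →+* L) ((gramR L e dV hdV dW hdW).map (algebraMap (Fp L) L)) → HA L e dV hdV dW hdW → Finset φ)
    (R : skewMatrices ((IsCMField.complexConj L : L ≃ₐ[Fp L] L) : L →+* L) ((gramR L e dV hdV dW hdW).map (algebraMap (Fp L) L)) → φ → Finset ρ)
    (T : skewMatrices ((IsCMField.complexConj L : L ≃ₐ[Fp L] L) : L →+* L) ((gramR L e dV hdV dW hdW).map (algebraMap (Fp L) L)) → HA L e dV hdV dW hdW →
      Finset (HeightOneSpectrum (𝓞 ↥(maximalRealSubfield L))))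
    (Gn : skewMatrices ((IsCMField.complexConj L : L ≃ₐ[Fp L] L) : L →+* L) ((gramR L e dV hdV dW hdW).map (algebraMap (Fp L) L)) → φ →
      HeightOneSpectrum (𝓞 ↥(maximalRealSubfield L)) → ℂ → HA L e dV hdV dW hdW → ℂ)
    (hbad : ∀ X : skewMatrices ((IsCMField.complexConj L : L ≃ₐ[Fp L] L) : L →+* L) ((gramR L e dV hdV dW hdW).map (algebraMap (Fp L) L)),
      (X : Matrix (Fin n) (Fin n) L) ≠ 0 → (X : Matrix (Fin n) (Fin n) L).det = 0 → ∀ (_j : ι X) (h : HA L e dV hdV dW hdW), ∀ i ∈ I X h, ∀ v ∈ T X h,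
      ¬ (hilbertSymbol (v.adicCompletion ↥(maximalRealSubfield L)) (algebraMap ↥(maximalRealSubfield L) _ (val X))
          (algebraMap ↥(maximalRealSubfield L) _ (cmQuadraticGenerator L : ↥(maximalRealSubfield L))) = -1 ↔ v ∈ S₁) → Gn X i v (1 / 2) h = 0) :
    ∀ X : skewMatrices ((IsCMField.complexConj L : L ≃ₐ[Fp L] L) : L →+* L) ((gramR L e dV hdV dW hdW).map (algebraMap (Fp L) L)),
      (X : Matrix (Fin n) (Fin n) L) ≠ 0 → (X : Matrix (Fin n) (Fin n) L).det = 0 → ∀ (_j : ι X) (h : HA L e dV hdV dW hdW), ∀ i ∈ (I X h).sigma (R X), ∀ v ∈ T X h,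
      ¬ (hilbertSymbol (v.adicCompletion ↥(maximalRealSubfield L)) (algebraMap ↥(maximalRealSubfield L) _ (val X))
          (algebraMap ↥(maximalRealSubfield L) _ (cmQuadraticGenerator L : ↥(maximalRealSubfield L))) = -1 ↔ v ∈ S₁) →
        (fun X (p : Sigma fun _ : φ => ρ) v s h => Gn X p.1 v s h) X i v (1 / 2) h = 0 :=
  fun X hX0 hdet j h p hp => hbad X hX0 hdet j h p.1 (Finset.mem_sigma.1 hp).1

/-- **THE CONTINUED DECOMPOSITION ON `{0 < re}` FROM THE RAW ONE (for payers whose `Ac` was chosen, not summed).**  ★ p863404's coarse `A Ac hAc hA`; fine raw blocks and continuations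
`A′ Ac′` with `hAc′` (holomorphy) and `hA′` (`A′ = Ac′` on `{1 < re}`); the RAW decomposition `A X j s h = Σ_{r ∈ R X j} A′ X ⟨j,r⟩ s h` on `{1 < re}` ⟹ `Ac X j s h = Σ_r Ac′ X ⟨j,r⟩ s h`
at every `0 < re s` (§1 `continuation_eq_sum`).  (The all-`s` form the `hEq` slot wants is then a matter of DEFINING the coarse continuation as the sum.)
[cite: Conway1978, IV §3 Thm. 3.7] [cite: Shimura1997, §18.4] -/
theorem ac_eq_sum_of_rawDecomposition {φ ρ : Type*}
    (I : skewMatrices ((IsCMField.complexConj L : L ≃ₐ[Fp L] L) : L →+* L) ((gramR L e dV hdV dW hdW).map (algebraMap (Fp L) L)) → HA L e dV hdV dW hdW → Finset φ)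
    (A Ac : skewMatrices ((IsCMField.complexConj L : L ≃ₐ[Fp L] L) : L →+* L) ((gramR L e dV hdV dW hdW).map (algebraMap (Fp L) L)) → φ → ℂ → HA L e dV hdV dW hdW → ℂ)
    (hAc : ∀ X : skewMatrices ((IsCMField.complexConj L : L ≃ₐ[Fp L] L) : L →+* L) ((gramR L e dV hdV dW hdW).map (algebraMap (Fp L) L)),
      (X : Matrix (Fin n) (Fin n) L) ≠ 0 → (X : Matrix (Fin n) (Fin n) L).det = 0 → ∀ (h : HA L e dV hdV dW hdW), ∀ i ∈ I X h,
        DifferentiableOn ℂ (fun s => Ac X i s h) {s : ℂ | 0 < s.re})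
    (hA : ∀ X : skewMatrices ((IsCMField.complexConj L : L ≃ₐ[Fp L] L) : L →+* L) ((gramR L e dV hdV dW hdW).map (algebraMap (Fp L) L)),
      (X : Matrix (Fin n) (Fin n) L) ≠ 0 → (X : Matrix (Fin n) (Fin n) L).det = 0 → ∀ (h : HA L e dV hdV dW hdW), ∀ i ∈ I X h, ∀ s : ℂ, 1 < s.re → A X i s h = Ac X i s h)
    (R : skewMatrices ((IsCMField.complexConj L : L ≃ₐ[Fp L] L) : L →+* L) ((gramR L e dV hdV dW hdW).map (algebraMap (Fp L) L)) → φ → Finset ρ)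
    (A' Ac' : skewMatrices ((IsCMField.complexConj L : L ≃ₐ[Fp L] L) : L →+* L) ((gramR L e dV hdV dW hdW).map (algebraMap (Fp L) L)) → (Sigma fun _ : φ => ρ) → ℂ →
      HA L e dV hdV dW hdW → ℂ)
    (hAc' : ∀ X : skewMatrices ((IsCMField.complexConj L : L ≃ₐ[Fp L] L) : L →+* L) ((gramR L e dV hdV dW hdW).map (algebraMap (Fp L) L)),
      (X : Matrix (Fin n) (Fin n) L) ≠ 0 → (X : Matrix (Fin n) (Fin n) L).det = 0 → ∀ (h : HA L e dV hdV dW hdW), ∀ j ∈ I X h, ∀ r ∈ R X j,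
        DifferentiableOn ℂ (fun s => Ac' X ⟨j, r⟩ s h) {s : ℂ | 0 < s.re})
    (hA' : ∀ X : skewMatrices ((IsCMField.complexConj L : L ≃ₐ[Fp L] L) : L →+* L) ((gramR L e dV hdV dW hdW).map (algebraMap (Fp L) L)),
      (X : Matrix (Fin n) (Fin n) L) ≠ 0 → (X : Matrix (Fin n) (Fin n) L).det = 0 → ∀ (h : HA L e dV hdV dW hdW), ∀ j ∈ I X h, ∀ r ∈ R X j,
        ∀ s : ℂ, 1 < s.re → A' X ⟨j, r⟩ s h = Ac' X ⟨j, r⟩ s h)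
    (hdec : ∀ X : skewMatrices ((IsCMField.complexConj L : L ≃ₐ[Fp L] L) : L →+* L) ((gramR L e dV hdV dW hdW).map (algebraMap (Fp L) L)),
      (X : Matrix (Fin n) (Fin n) L) ≠ 0 → (X : Matrix (Fin n) (Fin n) L).det = 0 → ∀ (h : HA L e dV hdV dW hdW), ∀ j ∈ I X h,
        ∀ s : ℂ, 1 < s.re → A X j s h = ∑ r ∈ R X j, A' X ⟨j, r⟩ s h) :
    ∀ X : skewMatrices ((IsCMField.complexConj L : L ≃ₐ[Fp L] L) : L →+* L) ((gramR L e dV hdV dW hdW).map (algebraMap (Fp L) L)),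
      (X : Matrix (Fin n) (Fin n) L) ≠ 0 → (X : Matrix (Fin n) (Fin n) L).det = 0 → ∀ (h : HA L e dV hdV dW hdW), ∀ j ∈ I X h,
        ∀ s : ℂ, 0 < s.re → Ac X j s h = ∑ r ∈ R X j, Ac' X ⟨j, r⟩ s h :=
  fun X hX0 hdet h j hj =>
    continuation_eq_sum zero_le_one (R X j) (A := fun s => A X j s h) (Ac := fun s => Ac X j s h) (hAc X hX0 hdet h j hj) (hA X hX0 hdet h j hj)
      (A' := fun r s => A' X ⟨j, r⟩ s h) (Ac' := fun r s => Ac' X ⟨j, r⟩ s h) (hAc' X hX0 hdet h j hj) (hA' X hX0 hdet h j hj) (hdec X hX0 hdet h j hj)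

end Frame

end Summit.HodgeConjecture.HodgeConjecture.Cruxes.HLiu418.K2LiuIncoherentRankOneFaceRefinement

end
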